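import Summits.AtomisticToContinuum.BoseEinsteinCondensation.Theorems.BECCutLineWeakDisorderTracerDefs
import Summits.AtomisticToContinuum.BoseEinsteinCondensation.Theorems.BECCutLineWeakDisorderTwoReplicaTransienceBoundDecoupling
import Literature.MathematicalPhysics.QuantumManyBody.JelliumOnsagerBound
import HarnessLib

/-!
# Route `BECCutLineWeakDisorder`, crux `TwoReplicaTransienceBound` (stmt-AtomisticToContinuum-9687),
# line `SketchIdeator1` (tracer decoupling): stub `stub_tiltedDecoupling` (v3 = v2 profile decoupling, `0 ≤ T`)

Support file (`--supports stmt-AtomisticToContinuum-9687`) for the registered stub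
`stub_tiltedDecoupling : Goal.stub_tiltedDecoupling` (statement `TiltedDecoupling` of
`Theorems/BECCutLineWeakDisorderTracerDefs.lean`: the v2 statement `ProfileDecoupling` under the
extra hypothesis `0 ≤ T`).

**Why `0 ≤ T`.** For `T < 0` nothing is killed and every action is empty, so `fkWeight ≡ 1`,
`fkPartition ≡ 1`, `tracer ≡ 1`; then `∫ₓ Z(x::Y)² = |ℝ³| = ⊤` while the right-hand side is
`⊤ · ∫ 1 · (⊤ / ⊤) dW_n = ⊤ · 0 = 0` — the v2 statement `ProfileDecoupling` (all real `T`) is false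
(lead's scratch refutation `work/stubs/ProfileDecouplingCounterexample.lean`). The composition only
uses `T ≥ 1`. This file proves `profileDecoupling_of_nonneg` (= `TiltedDecoupling` unfolded) and
the stub `stub_tiltedDecoupling` is the one-liner at the end.

**Proof.** Write `w = fkWeight v L T Y`, `g(x, ωb) = tracer v L T x Y ωb`, `G(ωb) = ∫ₓ g(x, ωb) dx`
(the profile mass; `G ≤ |Λ_L| < ⊤` because for `T ≥ 0` the tagged line started outside `Λ_L` is
killed at time `0`). Paths with `G(ωb) = 0` carry `g(·, ωb) = 0` a.e. in `x`, hence (Tonelli) do not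
contribute to `Z(x::Y) = ∫ w g(x,·) dW_n` for a.e. `x`. On `{G ≠ 0}`, pointwise in `x`,
`w g(x,·) = (w G)^{1/2} · (w G⁻¹ g(x,·)²)^{1/2}`, so Hölder (`p = q = 2`) gives
`Z(x::Y)² ≤ (∫ w G dW_n) · ∫ w G⁻¹ g(x,·)² dW_n`; integrating in `x` and swapping the integrals
(Tonelli, joint measurability from hypothesis 2) yields
`∫ₓ Z² ≤ (∫ w G) · ∫ w (∫ₓ g²)/G dW_n`, and `∫ w G dW_n = ∫ₓ Z(x::Y) dx` (Tonelli + hypothesis 1).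
-/

noncomputable section

namespace Summit.AtomisticToContinuum.BoseEinsteinCondensation.Cruxes.TwoReplicaTransienceBound.TracerDecoupling

open MeasureTheory Filter Set
open scoped ENNReal NNReal Topology BigOperators
open Literature.MathematicalPhysics.QuantumManyBody.BoseGas

variable {n : ℕ}

/-! ### Abstract measure theory: profile-weighted Cauchy–Schwarz and Tonelli -/

/-- **Weighted Cauchy–Schwarz on the set of positive, finite profile mass**: for measurable
`w, G, h : Ω → [0, ∞]` and a measurable set `A` on which `0 < G < ⊤`,
`(∫_A w h)² ≤ (∫_A w G) · ∫_A w G⁻¹ h²` (Hölder with exponents `2, 2` applied to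
`(w G)^{1/2}` and `(w G⁻¹ h²)^{1/2}`, whose product is `w h` on `A`). -/
theorem setLIntegral_mul_sq_le {Ω : Type*} [MeasurableSpace Ω] (μ : Measure Ω)
    {w G h : Ω → ℝ≥0∞} (hw : Measurable w) (hGm : Measurable G) (hh : Measurable h)
    {A : Set Ω} (hA : MeasurableSet A) (hA0 : ∀ ω ∈ A, G ω ≠ 0) (hAt : ∀ ω ∈ A, G ω ≠ ⊤) :
    (∫⁻ ω in A, w ω * h ω ∂μ) ^ 2 ≤
      (∫⁻ ω in A, w ω * G ω ∂μ) * ∫⁻ ω in A, w ω * (G ω)⁻¹ * h ω ^ 2 ∂μ := by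
  set F₁ : Ω → ℝ≥0∞ := fun ω => (w ω * G ω) ^ (1 / (2 : ℝ)) with hF₁def
  set F₂ : Ω → ℝ≥0∞ := fun ω => (w ω * (G ω)⁻¹ * h ω ^ 2) ^ (1 / (2 : ℝ)) with hF₂def
  have hF₁ : Measurable F₁ := (hw.mul hGm).pow_const _
  have hF₂ : Measurable F₂ := ((hw.mul hGm.inv).mul (hh.pow_const 2)).pow_const _
  -- on `A` the product of the two Hölder factors is the integrand `w h`
  have hle : ∀ ω ∈ A, w ω * h ω ≤ (F₁ * F₂) ω := fun ω hω => by
    have halg : w ω * G ω * (w ω * (G ω)⁻¹ * h ω ^ 2) = (w ω * h ω) ^ 2 := by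
      calc w ω * G ω * (w ω * (G ω)⁻¹ * h ω ^ 2)
          = (w ω * h ω) ^ 2 * (G ω * (G ω)⁻¹) := by ring
        _ = (w ω * h ω) ^ 2 := by rw [ENNReal.mul_inv_cancel (hA0 ω hω) (hAt ω hω), mul_one]
    rw [Pi.mul_apply, hF₁def, hF₂def]
    dsimp only
    rw [← ENNReal.mul_rpow_of_nonneg _ _ (by norm_num : (0 : ℝ) ≤ 1 / 2), halg,
      ← ENNReal.rpow_two, ← ENNReal.rpow_mul]
    norm_num
  have hH := ENNReal.lintegral_mul_le_Lp_mul_Lq (μ.restrict A) Real.HolderConjugate.two_two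
    hF₁.aemeasurable hF₂.aemeasurable
  have h₁ : ∀ ω, F₁ ω ^ (2 : ℝ) = w ω * G ω := fun ω => by
    rw [hF₁def]
    dsimp only
    rw [← ENNReal.rpow_mul]
    norm_num
  have h₂ : ∀ ω, F₂ ω ^ (2 : ℝ) = w ω * (G ω)⁻¹ * h ω ^ 2 := fun ω => by
    rw [hF₂def]
    dsimp only
    rw [← ENNReal.rpow_mul]
    norm_num
  calc (∫⁻ ω in A, w ω * h ω ∂μ) ^ 2
      ≤ (∫⁻ ω in A, (F₁ * F₂) ω ∂μ) ^ 2 := pow_le_pow_left' (setLIntegral_mono' hA hle) 2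
    _ ≤ ((∫⁻ ω in A, F₁ ω ^ (2 : ℝ) ∂μ) ^ (1 / (2 : ℝ)) *
          (∫⁻ ω in A, F₂ ω ^ (2 : ℝ) ∂μ) ^ (1 / (2 : ℝ))) ^ 2 := pow_le_pow_left' hH 2
    _ = (∫⁻ ω in A, F₁ ω ^ (2 : ℝ) ∂μ) * ∫⁻ ω in A, F₂ ω ^ (2 : ℝ) ∂μ :=
        sq_rpow_half_mul_rpow_half _ _
    _ = (∫⁻ ω in A, w ω * G ω ∂μ) * ∫⁻ ω in A, w ω * (G ω)⁻¹ * h ω ^ 2 ∂μ := by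
        simp_rw [h₁, h₂]

/-- **Profile decoupling, abstract form.** Let `ν` (on `α`) and `μ` (on `Ω`) be s-finite measures,
`w : Ω → [0, ∞]` measurable and `g : α → Ω → [0, ∞]` jointly measurable with finite profile masses
`G(ω) = ∫ g(x, ω) dν(x) < ⊤`. Then
`∫ (∫ w(ω) g(x, ω) dμ)² dν ≤ (∫∫ w g dμ dν) · ∫ w(ω) · (∫ g(x, ω)² dν / G(ω)) dμ`
(paths of zero profile mass do not contribute for a.e. `x`; on `{G ≠ 0}` the pointwise weighted
Cauchy–Schwarz `setLIntegral_mul_sq_le`; then Tonelli twice). -/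
theorem lintegral_sq_lintegral_mul_le {α Ω : Type*} [MeasurableSpace α] [MeasurableSpace Ω]
    (ν : Measure α) (μ : Measure Ω) [SFinite ν] [SFinite μ]
    {w : Ω → ℝ≥0∞} (hw : Measurable w) {g : α → Ω → ℝ≥0∞} (hg : Measurable (Function.uncurry g))
    (hG : ∀ ω, ∫⁻ x, g x ω ∂ν ≠ ⊤) :
    ∫⁻ x, (∫⁻ ω, w ω * g x ω ∂μ) ^ 2 ∂ν ≤
      (∫⁻ x, ∫⁻ ω, w ω * g x ω ∂μ ∂ν) *
        ∫⁻ ω, w ω * ((∫⁻ x, g x ω ^ 2 ∂ν) / ∫⁻ x, g x ω ∂ν) ∂μ := by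
  -- the profile mass `G` and the set `A = {G ≠ 0}`
  set G : Ω → ℝ≥0∞ := fun ω => ∫⁻ x, g x ω ∂ν with hGdef
  have hGm : Measurable G := hg.lintegral_prod_left
  have hgx : ∀ x, Measurable (g x) := fun x => hg.of_uncurry_left
  have hgω : ∀ ω, Measurable fun x => g x ω := fun ω => hg.of_uncurry_right
  have hF : Measurable (Function.uncurry fun x ω => w ω * g x ω) :=
    (hw.comp measurable_snd).mul hg
  have hF2 : Measurable (Function.uncurry fun x ω => w ω * (G ω)⁻¹ * g x ω ^ 2) :=
    ((hw.comp measurable_snd).mul (hGm.comp measurable_snd).inv).mul (hg.pow_const 2)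
  set A : Set Ω := {ω | G ω ≠ 0} with hAdef
  have hA : MeasurableSet A := hGm (measurableSet_singleton 0).compl
  -- (i) paths of zero profile mass do not contribute, for a.e. `x`
  have hR : ∀ᵐ x ∂ν, ∫⁻ ω in Aᶜ, w ω * g x ω ∂μ = 0 := by
    have hmeas : Measurable fun x => ∫⁻ ω in Aᶜ, w ω * g x ω ∂μ :=
      hF.lintegral_prod_right
    refine (lintegral_eq_zero_iff' hmeas.aemeasurable).1 ?_
    rw [lintegral_lintegral_swap hF.aemeasurable]
    have h0 : ∀ ω ∈ Aᶜ, ∫⁻ x, w ω * g x ω ∂ν = 0 := fun ω hω => by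
      have hG0 : G ω = 0 := by
        by_contra h
        exact hω h
      rw [lintegral_const_mul _ (hgω ω)]
      change w ω * G ω = 0
      rw [hG0, mul_zero]
    rw [setLIntegral_congr_fun hA.compl h0, lintegral_zero]
  have hZ : ∀ᵐ x ∂ν, ∫⁻ ω, w ω * g x ω ∂μ = ∫⁻ ω in A, w ω * g x ω ∂μ := by
    filter_upwards [hR] with x hx
    rw [← lintegral_add_compl (fun ω => w ω * g x ω) hA, hx, add_zero]
  -- (ii) pointwise weighted Cauchy–Schwarz on `A`
  have hpt : ∀ x, (∫⁻ ω in A, w ω * g x ω ∂μ) ^ 2 ≤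
      (∫⁻ ω in A, w ω * G ω ∂μ) * ∫⁻ ω in A, w ω * (G ω)⁻¹ * g x ω ^ 2 ∂μ := fun x =>
    setLIntegral_mul_sq_le μ hw hGm (hgx x) hA (fun ω hω => hω) (fun ω _ => hG ω)
  -- (iii) Tonelli
  have hwG : ∫⁻ ω, w ω * G ω ∂μ = ∫⁻ x, ∫⁻ ω, w ω * g x ω ∂μ ∂ν := by
    calc ∫⁻ ω, w ω * G ω ∂μ = ∫⁻ ω, ∫⁻ x, w ω * g x ω ∂ν ∂μ :=
          lintegral_congr fun ω => (lintegral_const_mul _ (hgω ω)).symm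
      _ = ∫⁻ x, ∫⁻ ω, w ω * g x ω ∂μ ∂ν := (lintegral_lintegral_swap hF.aemeasurable).symm
  have hQ : ∫⁻ x, ∫⁻ ω, w ω * (G ω)⁻¹ * g x ω ^ 2 ∂μ ∂ν =
      ∫⁻ ω, w ω * ((∫⁻ x, g x ω ^ 2 ∂ν) / G ω) ∂μ := by
    rw [lintegral_lintegral_swap hF2.aemeasurable]
    refine lintegral_congr fun ω => ?_
    rw [lintegral_const_mul _ ((hgω ω).pow_const 2), div_eq_mul_inv]
    ring
  calc ∫⁻ x, (∫⁻ ω, w ω * g x ω ∂μ) ^ 2 ∂ν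
      = ∫⁻ x, (∫⁻ ω in A, w ω * g x ω ∂μ) ^ 2 ∂ν :=
        lintegral_congr_ae (by filter_upwards [hZ] with x hx; rw [hx])
    _ ≤ ∫⁻ x, (∫⁻ ω in A, w ω * G ω ∂μ) * ∫⁻ ω in A, w ω * (G ω)⁻¹ * g x ω ^ 2 ∂μ ∂ν :=
        lintegral_mono hpt
    _ = (∫⁻ ω in A, w ω * G ω ∂μ) * ∫⁻ x, ∫⁻ ω in A, w ω * (G ω)⁻¹ * g x ω ^ 2 ∂μ ∂ν :=
        lintegral_const_mul _ hF2.lintegral_prod_right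
    _ ≤ (∫⁻ ω, w ω * G ω ∂μ) * ∫⁻ x, ∫⁻ ω, w ω * (G ω)⁻¹ * g x ω ^ 2 ∂μ ∂ν :=
        mul_le_mul' (setLIntegral_le_lintegral A _)
          (lintegral_mono fun x => setLIntegral_le_lintegral A _)
    _ = (∫⁻ x, ∫⁻ ω, w ω * g x ω ∂μ ∂ν) * ∫⁻ ω, w ω * ((∫⁻ x, g x ω ^ 2 ∂ν) / G ω) ∂μ := by
        rw [hwG, hQ]

/-! ### The tracer profile has finite mass for `T ≥ 0` -/

/-- Dirichlet killing of the tagged line at time `0`: for `T ≥ 0` the tracer functional vanishes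
from a starting point outside the open box. -/
theorem tracer_of_notMem (v : ℝ → ℝ≥0∞) {L T : ℝ} (hT : 0 ≤ T) {x : Space} (hx : x ∉ box L)
    (Y : Config n) (ωb : PathSpace n) : tracer v L T x Y ωb = 0 := by
  have hS : survives (N := 1) L T (fun _ => x) = ∅ :=
    Set.eq_empty_of_forall_notMem fun ω hω => hx (by simpa [boxN] using hω 0 ⟨le_rfl, hT⟩)
  simp [tracer_def, hS]

/-- For `T ≥ 0` the tracer profile is dominated by the indicator of the box. -/
theorem tracer_le_indicator (v : ℝ → ℝ≥0∞) {L T : ℝ} (hT : 0 ≤ T) (x : Space) (Y : Config n)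
    (ωb : PathSpace n) : tracer v L T x Y ωb ≤ (box L).indicator (1 : Space → ℝ≥0∞) x := by
  by_cases hx : x ∈ box L
  · rw [Set.indicator_of_mem hx]
    exact tracer_le_one v L T x Y ωb
  · simp [tracer_of_notMem v hT hx, hx]

/-- For `T ≥ 0` the profile mass `G(ωb) = ∫ₓ tracer(x, Y, ωb) dx ≤ |Λ_L|` is finite. -/
theorem lintegral_tracer_ne_top (v : ℝ → ℝ≥0∞) {L T : ℝ} (hT : 0 ≤ T) (Y : Config n)
    (ωb : PathSpace n) : ∫⁻ x, tracer v L T x Y ωb ≠ ⊤ := by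
  refine ne_top_of_le_ne_top
    (Literature.MathematicalPhysics.QuantumManyBody.JelliumBoseGas.volume_box_lt_top L).ne ?_
  calc ∫⁻ x, tracer v L T x Y ωb ≤ ∫⁻ x, (box L).indicator (1 : Space → ℝ≥0∞) x :=
        lintegral_mono fun x => tracer_le_indicator v hT x Y ωb
    _ = volume (box L) := lintegral_indicator_one (measurableSet_box L)

/-! ### Profile decoupling for `T ≥ 0` -/

/-- **Profile decoupling** (the registered statement `ProfileDecoupling` with the missing hypothesis
`0 ≤ T`): for measurable `v`, all `L`, `T ≥ 0`, `Y`, given the factorisation of `Z_T(·::Y)` through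
the tracer and the joint measurability of the tracer functional,
`∫ₓ Z_T(x::Y)² ≤ (∫ₓ Z_T(x::Y)) · ∫ fkWeight v L T Y ωb · (∫ₓ tracer² / ∫ₓ tracer) dW_n(ωb)`. -/
theorem profileDecoupling_of_nonneg :
    ∀ (n : ℕ) (v : ℝ → ℝ≥0∞), Measurable v → ∀ (L T : ℝ) (Y : Config n), 0 ≤ T →
    (∀ x : Space, fkPartition v L T (Matrix.vecCons x Y) =
      ∫⁻ ωb, fkWeight v L T Y ωb * tracer v L T x Y ωb ∂wienerPaths n) →
    (Measurable fun p : Space × PathSpace n => tracer v L T p.1 Y p.2) →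
    ∫⁻ x, fkPartition v L T (Matrix.vecCons x Y) ^ 2 ≤
      (∫⁻ x, fkPartition v L T (Matrix.vecCons x Y)) *
        ∫⁻ ωb, fkWeight v L T Y ωb *
          ((∫⁻ x, tracer v L T x Y ωb ^ 2) / ∫⁻ x, tracer v L T x Y ωb) ∂wienerPaths n := by
  intro n v hv L T Y hT hF hM
  simp_rw [hF]
  exact lintegral_sq_lintegral_mul_le volume (wienerPaths n) (measurable_fkWeight hv L T Y)
    (g := fun x ωb => tracer v L T x Y ωb) hM (fun ωb => lintegral_tracer_ne_top v hT Y ωb)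

/-- Registered stub `stub_tiltedDecoupling` of line SketchIdeator1 v3 (statement `TiltedDecoupling`
of `Theorems/BECCutLineWeakDisorderTracerDefs.lean` = `ProfileDecoupling` under `0 ≤ T`). -/
theorem stub_tiltedDecoupling : Goal.stub_tiltedDecoupling := by
  intro n v hv L T Y hT hF hM
  exact profileDecoupling_of_nonneg n v hv L T Y hT hF hM

end Summit.AtomisticToContinuum.BoseEinsteinCondensation.Cruxes.TwoReplicaTransienceBound.TracerDecoupling

end
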